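import Summits.ResolutionOfSingularities.ResolutionOfSingularities.Theorems.EquisingularLiftEquisingularLiftNatNDInvariants
import Literature.AlgebraicGeometry.Motives.ProjectiveSpaceCells
import Literature.AlgebraicGeometry.Resolution.SNCStrataSmooth
import Literature.AlgebraicGeometry.Resolution.StalkIdealLemmas
import HarnessLib

/-!
# Crux EL♮(3) `EquisingularLiftNatThree` (stmt-ResolutionOfSingularities-20148), chain W4.5b — DEAL «ND-K5» brick (B4γ) `ndInv_init`,
# part 2: THE CHART RING MAP `χ : k[t] → 𝒪_{ℙⁿ,x}` at a point of the standard chart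

[OURS · L1 W4.5b · EL♮(3) stmt-ResolutionOfSingularities-20148 · (B4γ) part 2 (γ3b of the feasibility memo) · res-type-027 g19 · helper,
`--supports`; def-free; nothing of the manuscript under review [Hironaka2017] is asserted; AI-written, weaker than expert review]

At `x = chartι k n i y₀` there is a ring map `χ : k[t₁,…,tₙ] → 𝒪_{ℙⁿ,x}` (germ at `y₀` followed by the inverse of the stalk isomorphism of
the open immersion `chartι`) exhibiting `𝒪_{ℙⁿ,x}` as the localisation `k[t]_{𝔭_{y₀}}`, agreeing with `ND.baseToStalk` on constants, and
computing stalks and supports of ideal sheaves through the chart ideal `J_I := Γ(chartι^* I) ⊆ k[t]`.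
References: R. Hartshorne, *Algebraic Geometry* (1977), II Prop. 2.5, II Prop. 2.2 [Hartshorne1977].
-/

set_option linter.dupNamespace false -- mandated namespace `Summit.<Summit>.<Problem>` of this single-conjunct summit

noncomputable section

open CategoryTheory AlgebraicGeometry TopologicalSpace IsLocalRing MvPolynomial
open Literature.AlgebraicGeometry.Resolution
open Literature.AlgebraicGeometry.Motives

namespace Summit.ResolutionOfSingularities.ResolutionOfSingularities.Cruxes.EquisingularLiftNat.Sections.ND

attribute [local instance] MvPolynomial.gradedAlgebra ProjBaseChange.algebraBase

variable (k : Type) [Field k] (n : ℕ)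

/-- The `i`-th chart is a morphism over `Spec k`: `chartι ≫ (ℙⁿ_k → Spec k) = Spec (k → k[t])`. [cite: Hartshorne1977, II Prop. 2.5] -/
theorem chartι_comp_hom (i : Fin (n + 1)) :
    ProjectiveSpaceCells.chartι k n i ≫ (projectiveSpace n k).hom =
      Spec.map (CommRingCat.ofHom (algebraMap k (MvPolynomial (Fin n) k))) := by
  rw [ProjectiveSpaceCells.chartι, Category.assoc]
  change (ProjectiveSpaceCells.chartSpecIso k n i).hom ≫
      Proj.awayι _ (X i : MvPolynomial (Fin (n + 1)) k) (ProjectiveSpace.X_mem i) zero_lt_one ≫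
        ProjBaseChange.projToSpec (Fin (n + 1)) k = _
  rw [ProjBaseChange.awayι_projToSpec (Fin (n + 1)) (ProjectiveSpace.X_mem i) zero_lt_one]
  change Spec.map (CommRingCat.ofHom (ProjectiveSpace.chartAlgEquiv k i).toRingEquiv.toRingHom) ≫
      Spec.map (CommRingCat.ofHom (algebraMap k _)) = _
  rw [← Spec.map_comp, ← CommRingCat.ofHom_comp]
  congr 2
  ext r
  simp

/-- Germs of global sections of `Spec R` are the structure map to the stalk. [folklore] -/
theorem germ_ΓSpecIso_inv {R : Type} [CommRing R] (y : Spec (CommRingCat.of R)) (r : R) :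
    ((Spec (CommRingCat.of R)).presheaf.germ ⊤ y trivial).hom ((Scheme.ΓSpecIso (CommRingCat.of R)).inv.hom r) =
      (StructureSheaf.toStalk R y).hom r := rfl

/-- **The chart ring map at a point of the standard chart.** For `x = chartι k n i y₀` there is `χ : k[t] → 𝒪_{ℙⁿ,x}` with:
`𝒪_{ℙⁿ,x}` is the localisation of `k[t]` at `𝔭_{y₀}` along `χ`; `χ` agrees with `ND.baseToStalk` on constants; for every ideal sheaf
`I` on `ℙⁿ`, with `J_I ⊆ k[t]` the ideal of global sections of `chartι^* I`, `I_x = χ(J_I)·𝒪_{ℙⁿ,x}` and, for every point `y` of the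
chart, `chartι y ∈ supp I ↔ J_I ⊆ 𝔭_y`. [cite: Hartshorne1977, II Prop. 2.5 and II Prop. 2.2] -/
theorem exists_chartRingHom (i : Fin (n + 1)) (y₀ : Spec (CommRingCat.of (MvPolynomial (Fin n) k))) :
    ∃ χ : MvPolynomial (Fin n) k →+* (projectiveSpace n k).left.presheaf.stalk (ProjectiveSpaceCells.chartι k n i y₀),
      (letI := χ.toAlgebra
       IsLocalization.AtPrime ((projectiveSpace n k).left.presheaf.stalk (ProjectiveSpaceCells.chartι k n i y₀)) y₀.asIdeal) ∧
      χ.comp MvPolynomial.C = baseToStalk n k (𝟙 _) (ProjectiveSpaceCells.chartι k n i y₀) ∧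
      (∀ I : (projectiveSpace n k).left.IdealSheafData,
        stalkIdeal I (ProjectiveSpaceCells.chartι k n i y₀) =
          (((I.comap (ProjectiveSpaceCells.chartι k n i)).ideal ⟨⊤, isAffineOpen_top _⟩).comap
            (Scheme.ΓSpecIso (CommRingCat.of (MvPolynomial (Fin n) k))).inv.hom).map χ) ∧
      (∀ (I : (projectiveSpace n k).left.IdealSheafData) (y : Spec (CommRingCat.of (MvPolynomial (Fin n) k))),
        ProjectiveSpaceCells.chartι k n i y ∈ I.support ↔
          ((I.comap (ProjectiveSpaceCells.chartι k n i)).ideal ⟨⊤, isAffineOpen_top _⟩).comap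
            (Scheme.ΓSpecIso (CommRingCat.of (MvPolynomial (Fin n) k))).inv.hom ≤ y.asIdeal) := by
  classical
  set φ := ProjectiveSpaceCells.chartι k n i with hφ
  haveI : IsOpenImmersion φ := by rw [hφ]; infer_instance
  haveI hiso : IsIso (φ.stalkMap y₀) := inferInstance
  -- the germ map of the affine chart and the inverse of the stalk isomorphism
  let γ : MvPolynomial (Fin n) k →+* (Spec (CommRingCat.of (MvPolynomial (Fin n) k))).presheaf.stalk y₀ :=
    (StructureSheaf.toStalk (MvPolynomial (Fin n) k) y₀).hom
  let ψi : (Spec (CommRingCat.of (MvPolynomial (Fin n) k))).presheaf.stalk y₀ →+*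
      (projectiveSpace n k).left.presheaf.stalk (φ y₀) := (inv (φ.stalkMap y₀)).hom
  have hinve : ∀ a, ψi ((φ.stalkMap y₀).hom a) = a := fun a => by
    change (φ.stalkMap y₀ ≫ inv (φ.stalkMap y₀)).hom a = a
    rw [IsIso.hom_inv_id]; rfl
  have heinv : ∀ a, (φ.stalkMap y₀).hom (ψi a) = a := fun a => by
    change (inv (φ.stalkMap y₀) ≫ φ.stalkMap y₀).hom a = a
    rw [IsIso.inv_hom_id]; rfl
  have hγ : ∀ r, γ r = ((Spec (CommRingCat.of (MvPolynomial (Fin n) k))).presheaf.germ ⊤ y₀ trivial).hom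
      ((Scheme.ΓSpecIso (CommRingCat.of (MvPolynomial (Fin n) k))).inv.hom r) := fun r => rfl
  have hΓ : ∀ s : Γ(Spec (CommRingCat.of (MvPolynomial (Fin n) k)), ⊤),
      (Scheme.ΓSpecIso (CommRingCat.of (MvPolynomial (Fin n) k))).inv.hom
        ((Scheme.ΓSpecIso (CommRingCat.of (MvPolynomial (Fin n) k))).hom.hom s) = s := fun s => by
    rw [← CommRingCat.comp_apply, Iso.hom_inv_id]; rfl
  let χ : MvPolynomial (Fin n) k →+* (projectiveSpace n k).left.presheaf.stalk (φ y₀) := ψi.comp γ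
  -- the ideal `J_I` through the global-sections isomorphism
  have hJ : ∀ I : (projectiveSpace n k).left.IdealSheafData,
      (((I.comap φ).ideal ⟨⊤, isAffineOpen_top _⟩).comap (Scheme.ΓSpecIso (CommRingCat.of (MvPolynomial (Fin n) k))).inv.hom).map χ =
        (((I.comap φ).ideal ⟨⊤, isAffineOpen_top _⟩).map
          ((Spec (CommRingCat.of (MvPolynomial (Fin n) k))).presheaf.germ ⊤ y₀ trivial).hom).map ψi := by
    intro I
    apply le_antisymm
    · rw [Ideal.map_le_iff_le_comap]
      intro r hr
      rw [Ideal.mem_comap] at hr ⊢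
      change ψi (γ r) ∈ _
      rw [hγ]
      exact Ideal.mem_map_of_mem _ (Ideal.mem_map_of_mem _ hr)
    · rw [Ideal.map_map, Ideal.map_le_iff_le_comap]
      intro s hs
      rw [Ideal.mem_comap]
      have hs' : (Scheme.ΓSpecIso (CommRingCat.of (MvPolynomial (Fin n) k))).hom.hom s ∈
          ((I.comap φ).ideal ⟨⊤, isAffineOpen_top _⟩).comap (Scheme.ΓSpecIso (CommRingCat.of (MvPolynomial (Fin n) k))).inv.hom := by
        rw [Ideal.mem_comap, hΓ]; exact hs
      have h1 := Ideal.mem_map_of_mem χ hs'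
      have h2 : χ ((Scheme.ΓSpecIso (CommRingCat.of (MvPolynomial (Fin n) k))).hom.hom s) =
          (ψi.comp ((Spec (CommRingCat.of (MvPolynomial (Fin n) k))).presheaf.germ ⊤ y₀ trivial).hom) s := by
        change ψi (γ _) = ψi _
        rw [hγ, hΓ]
      rw [h2] at h1
      exact h1
  refine ⟨χ, ?_, ?_, fun I => ?_, fun I y => ?_⟩
  · -- localisation, transported along the stalk isomorphism
    letI := χ.toAlgebra
    let f : (Spec (CommRingCat.of (MvPolynomial (Fin n) k))).presheaf.stalk y₀ ≃+*
        (projectiveSpace n k).left.presheaf.stalk (φ y₀) := (asIso (φ.stalkMap y₀)).symm.commRingCatIsoToRingEquiv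
    let g : (Spec (CommRingCat.of (MvPolynomial (Fin n) k))).presheaf.stalk y₀ ≃ₐ[MvPolynomial (Fin n) k]
        (projectiveSpace n k).left.presheaf.stalk (φ y₀) := AlgEquiv.ofRingEquiv (f := f) (fun r => rfl)
    exact IsLocalization.isLocalization_of_algEquiv y₀.asIdeal.primeCompl g
  · -- constants
    ext c
    have hmor : (projectiveSpace n k).left.presheaf.germ ⊤ (φ y₀) trivial ≫ φ.stalkMap y₀ =
        φ.appTop ≫ (Spec (CommRingCat.of (MvPolynomial (Fin n) k))).presheaf.germ ⊤ y₀ trivial :=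
      Scheme.Hom.germ_stalkMap φ ⊤ y₀ trivial
    have happ : (φ ≫ (𝟙 _ ≫ (projectiveSpace n k).hom)).appTop =
        (Spec.map (CommRingCat.ofHom (algebraMap k (MvPolynomial (Fin n) k)))).appTop := by
      rw [Category.id_comp, hφ, chartι_comp_hom]
    have hnat : (Scheme.ΓSpecIso (CommRingCat.of k)).inv ≫
        (Spec.map (CommRingCat.ofHom (algebraMap k (MvPolynomial (Fin n) k)))).appTop =
          CommRingCat.ofHom (algebraMap k (MvPolynomial (Fin n) k)) ≫ (Scheme.ΓSpecIso (CommRingCat.of (MvPolynomial (Fin n) k))).inv :=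
      (Scheme.ΓSpecIso_inv_naturality _).symm
    have h1 : (φ.stalkMap y₀).hom (baseToStalk n k (𝟙 _) (φ y₀) c) = γ (C c) := by
      have e1 := congrArg (fun f => f.hom (((𝟙 _ ≫ (projectiveSpace n k).hom).appTop).hom
        ((Scheme.ΓSpecIso (CommRingCat.of k)).inv.hom c))) hmor
      have e2 := congrArg (fun f => f.hom ((Scheme.ΓSpecIso (CommRingCat.of k)).inv.hom c)) happ
      have e3 := congrArg (fun f => f.hom c) hnat
      simp only [Scheme.Hom.comp_appTop, CommRingCat.hom_comp, RingHom.coe_comp, Function.comp_apply] at e1 e2 e3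
      refine e1.trans ?_
      refine (congrArg ((Spec (CommRingCat.of (MvPolynomial (Fin n) k))).presheaf.germ ⊤ y₀ trivial).hom e2).trans ?_
      refine (congrArg ((Spec (CommRingCat.of (MvPolynomial (Fin n) k))).presheaf.germ ⊤ y₀ trivial).hom e3).trans ?_
      rw [hγ]
      rfl
    rw [RingHom.comp_apply, ← hinve (baseToStalk n k (𝟙 _) (φ y₀) c), h1]
    rfl
  · -- stalks of ideal sheaves
    have h1 := stalkIdeal_comap_eq_map_stalkMap φ I y₀
    have h2 := stalkIdeal_eq_map_germ (I.comap φ) ⟨⊤, isAffineOpen_top _⟩ (Opens.mem_top y₀)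
    have h12 : ((I.comap φ).ideal ⟨⊤, isAffineOpen_top _⟩).map
        ((Spec (CommRingCat.of (MvPolynomial (Fin n) k))).presheaf.germ ⊤ y₀ trivial).hom =
          (stalkIdeal I (φ y₀)).map (φ.stalkMap y₀).hom := h2.symm.trans h1
    have hid : ψi.comp (φ.stalkMap y₀).hom = RingHom.id _ := RingHom.ext fun a => hinve a
    rw [hJ I, h12]
    erw [Ideal.map_map, hid, Ideal.map_id]
  · -- supports
    have h1 : φ y ∈ I.support ↔ y ∈ (I.comap φ).support := by
      rw [Scheme.IdealSheafData.support_comap]; rfl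
    rw [h1, Scheme.IdealSheafData.mem_support_iff_of_mem (I := I.comap φ) (U := ⟨⊤, isAffineOpen_top _⟩) (Opens.mem_top y),
      Scheme.mem_zeroLocus_iff]
    constructor
    · intro h r hr
      rw [Ideal.mem_comap] at hr
      have h2 := h _ hr
      rw [Scheme.mem_basicOpen_top, germ_ΓSpecIso_inv] at h2
      by_contra hry
      exact h2 (IsLocalization.map_units ((Spec.structureSheaf (MvPolynomial (Fin n) k)).presheaf.stalk y)
        (⟨r, hry⟩ : y.asIdeal.primeCompl))
    · intro h s hs hys
      have hs' : (Scheme.ΓSpecIso (CommRingCat.of (MvPolynomial (Fin n) k))).hom.hom s ∈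
          ((I.comap φ).ideal ⟨⊤, isAffineOpen_top _⟩).comap (Scheme.ΓSpecIso (CommRingCat.of (MvPolynomial (Fin n) k))).inv.hom := by
        rw [Ideal.mem_comap, hΓ]; exact hs
      have h3 := h hs'
      rw [Scheme.mem_basicOpen_top, ← hΓ s, germ_ΓSpecIso_inv] at hys
      exact ((IsLocalization.AtPrime.isUnit_to_map_iff ((Spec.structureSheaf (MvPolynomial (Fin n) k)).presheaf.stalk y)
        y.asIdeal _).mp hys) h3

end Summit.ResolutionOfSingularities.ResolutionOfSingularities.Cruxes.EquisingularLiftNat.Sections.ND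

end
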